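import Literature.Computability.Complexity.BakerGillSolovay
import Literature.Computability.Complexity.MultilinearExtension
import HarnessLib

/-!
# Wilson's oracle: `Δ₂^{P,B}` has linear-size oracle circuits (the stage construction)

Trunk `CplxCore`, companion of `Oracle.lean` and `BakerGillSolovay.lean`. This file carries out
the oracle construction of C. B. Wilson, *Relativized circuit complexity*, J. Comput. Syst. Sci.
31 (1985) 169–181, Lemma 2 (pp. 173–175), in the form needed for his Theorem 3.1
("`∃ B, Δ₂^{P,B} ⊆ SIZE^B(2n + o(n))`", p. 175; tree fact
`Literature.Barriers.PneNP.Wilson1985_thm_3_1`, discharged from the present file in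
`Literature/Barriers/PneNP/RelativizedCircuitSizeProofs.lean`, where the circuits — one oracle
gate querying the code below — and the `o(n)` accounting live). The main theorem here is the
**coding theorem** `Wilson.code_mem_oracle_iff`: relative to the constructed oracle `B`, for every
description `d` of a language `L ∈ Δ₂^{P,B}` and EVERY input `x`,
`1^d 0 x α_{s(d,|x|)} ∈ B ↔ x ∈ L`, where the hard-wired suffix `α_s` has length
`s + (log₂ s)² + 3 log₂(s+1) + 5` and the stage `s(d, n)` equals `n` for all large `n`.

## Part I — forcing the `NP^B` level (Wilson, proof of Lemma 2, Stage `N`, Step 1)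

In the tree's transcript model (`OracleAlg`, `PRel`, `NPRel = polyExists ∘ PRel`, `PRelClass`) a
language `L ∈ Δ₂^{P,B} = P^{NP^B}` is witnessed by a **description** `D = (M, q; V, q_V; p)`
(`Wilson.Descr`, `Wilson.exists_describes`): `L` is decided by `M` within `q |x|` rounds relative
to `K = {y | ∃ w, |w| ≤ p |y| ∧ ⟨y, w⟩ ∈ K'}`, where `K'` is decided by `V` within `q_V` rounds
relative to `B` (`Descr.Kprime`, `Descr.Kset`; Wilson's `NP^B`-complete `K(B)`, here one `NP^B`
language per description). Wilson answers each query `y` of `M` to the `NP^B` oracle by FORCING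
(p. 174): "if `(j, y, 0^m) ∉ K(B)`, we will see if we can force `NM_j` to accept `y` by adding
certain [unreserved] strings to `B` ... if at this point `(j, y, 0^m) ∈ K(B)`, we choose some
accepting computation of `NM_j^B` on `y` and reserve the at most `m` unreserved strings queried
on that computation ... [otherwise] further changes to `B` cannot cause any `NM_j^B` to change
its behavior on `y`". We render this as a genericity argument over finite **conditions**
`σ = (I, O)` (strings committed IN / OUT, `Wilson.Cond`; a set *meets* `σ` if it contains `I`
and avoids `O`, `Wilson.Meets`):

* `Wilson.VYes D σ z` — `V` accepts `z` relative to `I` with all its queries committed; stable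
  under every set meeting `σ` (`VYes.mem_Kprime`, by `OracleAlg.run_congr`);
* `Wilson.KYes` (some short witness is `VYes`) and `Wilson.KNo` (no disjoint extension has
  `KYes`), the latter stable as well (`KNo.not_mem_Kset`: an accepting run relative to a set
  meeting `σ` transfers to the extension of `σ` by that run's verdicts, `Cond.extendBy`,
  `vYes_extendBy`);
* `Wilson.exists_decide` — every condition has an extension deciding `y` with at most
  `q_V(2|y| + 2 + p|y|)` new commitments (`Descr.vb`), disjoint if the condition is;
* `Wilson.sim` / `Wilson.runAux_eq_sim` — the round-by-round simulation of `M` on `x` deciding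
  each query (a query longer than `q |x|`, which a genuine `P^K`-machine never asks, aborts it)
  IS the true run relative to `K(S)` for every `S` meeting the final condition;
  `Wilson.card_sim_le` counts its commitments (`≤ Descr.cost |x|`), and `Wilson.process` /
  `Descr.Describes.process_eq` record the correct verdict bit `[x ∈ L]`.

## Part II — the stages (Wilson, Stage `N`, Step 2, and the count on p. 175)

The oracle is built against a sequence `e : ℕ → Descr` (later an enumeration of all
polynomial-time descriptions):

* the **clock** `T(s) = 2^{(log₂ s)²} = s^{log₂ s}` (`Wilson.clock`; Wilson's `T(n) = n^{log n}`
  for Thm. 3.1) eventually dominates every polynomial (`exists_eval_lt_clock`); the block of all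
  inputs of length `n` of description `d` is **scheduled** at `sched e d n`, the least
  `s ≥ max d n` with `cost_d(n) < T(s)` — equal to `n` for all large `n`
  (`exists_sched_eq_self`; Wilson: time bounds hold "for sufficiently large `n`", p. 171);
* **stage `s`** (`stageNext`) processes in turn all pairs `(d, x)` scheduled at `s`
  (`blockList`, at most `(s+1)² 2^s` entries; `procList`), chooses a **fresh suffix** `α_s` of
  length `sufLen s` that is the suffix of no committed string — fewer than `2^{sufLen s}` strings
  are committed (`card_midCond_lt`; p. 175: "the total number of reserved strings is less than
  `2^{N+3} T(N) = 2^{log T(N)+N+3}`. So there will always be an `α`") — and commits the **code**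
  `1^d 0 x α_s` (`Wilson.code`, Wilson's `⟨i, x⟩α`) IN for accepted and OUT for rejected pairs
  ("Put all of `S₁α` into `B`, reserve all of `S₀α` for `B̄`");
* the **oracle** `Wilson.oracle e = ⋃_s I_s` meets every stage condition (`meets_stageCond`,
  from disjointness `stageCond_disj`), so every recorded bit of a genuine description is correct
  (`results_correct`), whence `code_mem_oracle_iff`.

Differences from the printed proof, all inessential: stages are indexed by the scheduled stage
rather than by the time bound `N = c_i n^{k_i}`, small inputs being caught up at the first
stage whose clock affords them (so every input is coded, not only the large ones); the forcing
is phrased by conditions rather than by a mutable oracle with reservations; the `NP^B` language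
is one per description; the code is `1^d 0 x α` rather than `⟨i, x⟩α`.

## References

* C. B. Wilson, *Relativized circuit complexity*, J. Comput. Syst. Sci. 31 (1985) 169–181, §2,
  Lemma 2 (pp. 173–175), Thm. 3.1 (p. 175) [Wilson1985] (held; `lit read
  paper:doi-10-1016-0022-0000-85-90040-6`, PDF page = journal page − 168).
* K.-I Ko, *Constructing oracles by lower bound techniques for circuits* (1989), §3 (stage
  constructions), §5 (the `NP(A)`-complete set `K(A)`) [Ko1989].
* S. Arora, B. Barak, *Computational Complexity: A Modern Approach* (2009), §3.4 [AroraBarakCC2009].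
-/

namespace Literature.Computability.Complexity

open _root_.Computability

namespace Wilson

/-! ### Descriptions of `Δ₂^{P,B}` languages -/

/-- A **description** of a language of `Δ₂^{P,B} = ⋃_{K ∈ NP^B} P^K` in the transcript model:
the `P^K`-algorithm `M` with its clock / query bound `q`, the verifier `V` of `K' ∈ P^B` with its
clock `qV`, and the witness-length bound `p` of `K = {y | ∃ w, |w| ≤ p|y|, ⟨y, w⟩ ∈ K'} ∈ NP^B`
(Wilson: the pair of a deterministic query machine `M_i` and the `NP^B`-complete set `K(B)`).
[cite: Wilson1985, Lemma 2 (proof, p. 173)] -/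
structure Descr where
  /-- the `P^K` oracle algorithm -/
  M : OracleAlg Bool
  /-- its round and query-length budget -/
  q : Polynomial ℕ
  /-- the verifier of `K' ∈ P^B` -/
  V : OracleAlg Bool
  /-- the verifier's round budget -/
  qV : Polynomial ℕ
  /-- the witness-length bound of `K ∈ NP^B` -/
  p : Polynomial ℕ

/-- `Descr` is inhabited (needed to enumerate descriptions by `ℕ`). [folklore] -/
instance : Nonempty Descr :=
  ⟨⟨OracleAlg.ofFun fun _ => false, 0, OracleAlg.ofFun fun _ => false, 0, 0⟩⟩

namespace Descr

variable (D : Descr)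

/-- `K'(S) = {z | V accepts z relative to S within q_V |z| rounds}`: the `P^S` language of the
verifier. [cite: Wilson1985, Lemma 2 (proof, p. 173: `K(B)`)] -/
def Kprime (S : Set (List Bool)) : Set (List Bool) :=
  {z | D.V.run (Oracle.ofLanguage S) (D.qV.eval z.length) z = some true}

/-- `K(S) = {y | ∃ w, |w| ≤ p |y| ∧ ⟨y, w⟩ ∈ K'(S)}`: the `NP^S` language queried by `M`
(Wilson's `NP^B`-complete `K(B)`, here one `NP^S` language per description).
[cite: Wilson1985, Lemma 2 (proof, p. 173)] -/
def Kset (S : Set (List Bool)) : Set (List Bool) :=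
  {y | ∃ w : List Bool, w.length ≤ D.p.eval y.length ∧ boolPair y w ∈ D.Kprime S}

/-- The commitment budget of one `K`-query of length `m`: `q_V(2m + 2 + p m)`, the round budget
of the verifier on a pair `⟨y, w⟩` with `|y| = m`, `|w| ≤ p m` (Wilson: "at most `m` of these
strings"). [cite: Wilson1985, Lemma 2 (proof, p. 174, step (a₁))] -/
def vb (m : ℕ) : ℕ :=
  D.qV.eval (2 * m + 2 + D.p.eval m)

/-- The commitment budget of one input of length `n`: `q n` rounds, each committing at most
`vb (q n)` strings (Wilson: each `⟨i, x⟩` "will cause at most `T(N)` strings to be reserved").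
[cite: Wilson1985, Lemma 2 (proof, p. 174)] -/
def cost (n : ℕ) : ℕ :=
  D.q.eval n * D.vb (D.q.eval n)

/-- The query budget is monotone. [folklore] -/
theorem vb_mono {m m' : ℕ} (h : m ≤ m') : D.vb m ≤ D.vb m' := by
  unfold vb
  refine TM2Iter.eval_mono _ ?_
  have := TM2Iter.eval_mono D.p h
  omega

end Descr

/-! ### Conditions -/

/-- A forcing **condition**: finitely many strings committed to lie IN the oracle (`I`, Wilson's
"strings placed in `B`") and finitely many committed to stay OUT (`O`, "reserved for `B̄`").
[cite: Wilson1985, Lemma 2 (proof, p. 174)] -/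
structure Cond where
  /-- strings committed to the oracle -/
  I : Finset (List Bool)
  /-- strings committed to the complement -/
  O : Finset (List Bool)

namespace Cond

/-- Extension of conditions: both commitments grow. [cite: Wilson1985, Lemma 2 (proof, p. 174)] -/
instance : Preorder Cond where
  le σ τ := σ.I ⊆ τ.I ∧ σ.O ⊆ τ.O
  le_refl _ := ⟨Finset.Subset.refl _, Finset.Subset.refl _⟩
  le_trans _ _ _ h₁ h₂ := ⟨h₁.1.trans h₂.1, h₁.2.trans h₂.2⟩

/-- Unfolding of `≤` on conditions. [folklore] -/
theorem le_def {σ τ : Cond} : σ ≤ τ ↔ σ.I ⊆ τ.I ∧ σ.O ⊆ τ.O :=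
  Iff.rfl

/-- A condition is *disjoint* if no string is committed both ways. [folklore] -/
def Disj (σ : Cond) : Prop :=
  Disjoint σ.I σ.O

/-- The committed strings of a condition (Wilson's "reserved strings"). [cite: Wilson1985, Lemma 2 (proof, p. 174)] -/
def committed (σ : Cond) : Finset (List Bool) :=
  σ.I ∪ σ.O

/-- The finite oracle of a condition: its IN-set as a language. [folklore] -/
def lang (σ : Cond) : Set (List Bool) :=
  ↑σ.I

/-- The empty condition. [folklore] -/
def empty : Cond :=
  ⟨∅, ∅⟩

/-- The empty condition is disjoint. [folklore] -/
theorem empty_disj : empty.Disj :=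
  Finset.disjoint_empty_left _

/-- The empty condition commits nothing. [folklore] -/
@[simp] theorem committed_empty : empty.committed = ∅ := by
  simp [committed, empty]

/-- Membership in the committed set. [folklore] -/
theorem mem_committed {σ : Cond} {u : List Bool} : u ∈ σ.committed ↔ u ∈ σ.I ∨ u ∈ σ.O :=
  Finset.mem_union

/-- Committed sets grow along extensions. [folklore] -/
theorem committed_mono {σ τ : Cond} (h : σ ≤ τ) : σ.committed ⊆ τ.committed :=
  Finset.union_subset_union h.1 h.2

/-- In a disjoint condition an OUT-string is not IN. [folklore] -/
theorem Disj.not_mem_I {σ : Cond} (h : σ.Disj) {u : List Bool} (hu : u ∈ σ.O) : u ∉ σ.I :=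
  fun hI => Finset.disjoint_left.1 h hI hu

/-- **Extension by the verdicts of a set**: commit every string of `Q` the way the set `S` has it
(Wilson: "reserve ... the strings queried on that computation"). [cite: Wilson1985, Lemma 2 (proof, p. 174, step (a₁))] -/
noncomputable def extendBy (σ : Cond) (Q : Finset (List Bool)) (S : Set (List Bool)) : Cond :=
  haveI := Classical.decPred (· ∈ S)
  ⟨σ.I ∪ Q.filter (· ∈ S), σ.O ∪ Q.filter (· ∉ S)⟩

/-- `extendBy` extends. [folklore] -/
theorem le_extendBy (σ : Cond) (Q : Finset (List Bool)) (S : Set (List Bool)) :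
    σ ≤ σ.extendBy Q S :=
  ⟨Finset.subset_union_left, Finset.subset_union_left⟩

/-- `extendBy` commits only the strings of `Q` anew. [folklore] -/
theorem committed_extendBy_subset (σ : Cond) (Q : Finset (List Bool)) (S : Set (List Bool)) :
    (σ.extendBy Q S).committed ⊆ σ.committed ∪ Q := by
  classical
  intro u hu
  simp only [extendBy, committed, Finset.mem_union, Finset.mem_filter] at hu ⊢
  tauto

/-- Membership in the IN-set of `extendBy`. [folklore] -/
theorem mem_extendBy_I {σ : Cond} {Q : Finset (List Bool)} {S : Set (List Bool)} {u : List Bool} :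
    u ∈ (σ.extendBy Q S).I ↔ u ∈ σ.I ∨ (u ∈ Q ∧ u ∈ S) := by
  unfold extendBy
  simp only [Finset.mem_union, Finset.mem_filter]

/-- Membership in the OUT-set of `extendBy`. [folklore] -/
theorem mem_extendBy_O {σ : Cond} {Q : Finset (List Bool)} {S : Set (List Bool)} {u : List Bool} :
    u ∈ (σ.extendBy Q S).O ↔ u ∈ σ.O ∨ (u ∈ Q ∧ u ∉ S) := by
  unfold extendBy
  simp only [Finset.mem_union, Finset.mem_filter]

end Cond

/-- A set `S` **meets** the condition `σ`: it contains every IN-string and no OUT-string.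
[cite: Wilson1985, Lemma 2 (proof, p. 174)] -/
def Meets (S : Set (List Bool)) (σ : Cond) : Prop :=
  (∀ u ∈ σ.I, u ∈ S) ∧ ∀ u ∈ σ.O, u ∉ S

/-- Meeting is antitone in the condition. [folklore] -/
theorem Meets.anti {S : Set (List Bool)} {σ τ : Cond} (h : Meets S τ) (hle : σ ≤ τ) : Meets S σ :=
  ⟨fun u hu => h.1 u (hle.1 hu), fun u hu => h.2 u (hle.2 hu)⟩

/-- The IN-set of a disjoint condition meets it. [folklore] -/
theorem meets_lang {σ : Cond} (hσ : σ.Disj) : Meets σ.lang σ :=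
  ⟨fun _ hu => hu, fun _ hu => hσ.not_mem_I hu⟩

/-- A set meeting a disjoint condition answers every committed query as the condition's own
finite oracle does. [cite: Wilson1985, Lemma 2 (proof, p. 174)] -/
theorem Meets.apply_eq {S : Set (List Bool)} {σ : Cond} (hS : Meets S σ) (hσ : σ.Disj)
    {u : List Bool} (hu : u ∈ σ.I ∨ u ∈ σ.O) :
    Oracle.ofLanguage S u = Oracle.ofLanguage σ.lang u := by
  refine Oracle.ofLanguage_apply_eq_of_iff ?_
  rcases hu with hu | hu
  · exact ⟨fun _ => hu, fun _ => hS.1 u hu⟩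
  · exact ⟨fun h => absurd h (hS.2 u hu), fun h => absurd h (hσ.not_mem_I hu)⟩

/-- `extendBy Q S` of a condition met by `S` is disjoint if the condition is. [folklore] -/
theorem Cond.extendBy_disj {σ : Cond} (hσ : σ.Disj) {S : Set (List Bool)} (hS : Meets S σ)
    (Q : Finset (List Bool)) : (σ.extendBy Q S).Disj := by
  refine Finset.disjoint_left.2 fun u hI hO => ?_
  rw [Cond.mem_extendBy_I] at hI
  rw [Cond.mem_extendBy_O] at hO
  rcases hI with hI | ⟨-, hI⟩ <;> rcases hO with hO | ⟨-, hO⟩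
  · exact Finset.disjoint_left.1 hσ hI hO
  · exact hO (hS.1 u hI)
  · exact hS.2 u hO hI
  · exact hO hI

/-- On `Q`, the IN-set of `extendBy Q S` agrees with `S` (given that `S` meets the condition). [folklore] -/
theorem Cond.mem_extendBy_I_iff_of_mem {σ : Cond} {S : Set (List Bool)} (hS : Meets S σ)
    {Q : Finset (List Bool)} {u : List Bool} (hu : u ∈ Q) :
    u ∈ (σ.extendBy Q S).I ↔ u ∈ S := by
  rw [Cond.mem_extendBy_I]
  exact ⟨fun h => h.elim (hS.1 u) And.right, fun h => Or.inr ⟨hu, h⟩⟩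

/-! ### Forcing the verifier and the `NP`-oracle -/

variable (D : Descr)

/-- **`σ` forces `z ∈ K'`**: the verifier accepts `z` relative to the IN-set of `σ` within its
budget, and every query of that run is committed (Wilson: an accepting computation all of whose
queried strings are reserved). [cite: Wilson1985, Lemma 2 (proof, p. 174, step (a₁))] -/
def VYes (σ : Cond) (z : List Bool) : Prop :=
  D.V.run (Oracle.ofLanguage σ.lang) (D.qV.eval z.length) z = some true ∧
    ∀ u ∈ D.V.queries (Oracle.ofLanguage σ.lang) (D.qV.eval z.length) z, u ∈ σ.I ∨ u ∈ σ.O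

/-- **`σ` forces `y ∈ K`**: some witness `w`, `|w| ≤ p |y|`, has `⟨y, w⟩` forced into `K'`.
[cite: Wilson1985, Lemma 2 (proof, p. 174, step (a₁))] -/
def KYes (σ : Cond) (y : List Bool) : Prop :=
  ∃ w : List Bool, w.length ≤ D.p.eval y.length ∧ VYes D σ (boolPair y w)

/-- **`σ` forces `y ∉ K`**: no disjoint extension of `σ` forces `y ∈ K` (Wilson: `y` cannot be
forced into `K(B)` "by adding certain [unreserved] strings to `B`").
[cite: Wilson1985, Lemma 2 (proof, p. 174, steps (a₁), (b))] -/
def KNo (σ : Cond) (y : List Bool) : Prop :=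
  ∀ τ : Cond, σ ≤ τ → τ.Disj → ¬ KYes D τ y

variable {D}

/-- A forced acceptance of the verifier persists relative to every set meeting the condition
(the run sees only committed strings, `OracleAlg.run_congr`). [cite: Wilson1985, Lemma 2 (proof, p. 174: "we have fixed the queries made")] -/
theorem VYes.mem_Kprime {σ : Cond} {z : List Bool} (h : VYes D σ z) (hσ : σ.Disj)
    {S : Set (List Bool)} (hS : Meets S σ) : z ∈ D.Kprime S := by
  change D.V.run (Oracle.ofLanguage S) (D.qV.eval z.length) z = some true
  rw [OracleAlg.run_congr D.V (O := Oracle.ofLanguage σ.lang) fun u hu => hS.apply_eq hσ (h.2 u hu)]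
  exact h.1

/-- A forced `y ∈ K` persists relative to every set meeting the condition. [cite: Wilson1985, Lemma 2 (proof, p. 174)] -/
theorem KYes.mem_Kset {σ : Cond} {y : List Bool} (h : KYes D σ y) (hσ : σ.Disj)
    {S : Set (List Bool)} (hS : Meets S σ) : y ∈ D.Kset S := by
  obtain ⟨w, hw, hV⟩ := h
  exact ⟨w, hw, hV.mem_Kprime hσ hS⟩

/-- A forced acceptance of the verifier transfers to every disjoint extension of a disjoint
condition (committed strings stay committed the same way). [cite: Wilson1985, Lemma 2 (proof, p. 174)] -/
theorem VYes.mono {σ τ : Cond} {z : List Bool} (h : VYes D σ z) (hσ : σ.Disj) (hτ : τ.Disj) (hle : σ ≤ τ) :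
    VYes D τ z := by
  have hS : Meets τ.lang σ := (meets_lang hτ).anti hle
  have hagree : ∀ u ∈ D.V.queries (Oracle.ofLanguage σ.lang) (D.qV.eval z.length) z,
      Oracle.ofLanguage τ.lang u = Oracle.ofLanguage σ.lang u :=
    fun u hu => hS.apply_eq hσ (h.2 u hu)
  refine ⟨?_, fun u hu => ?_⟩
  · rw [OracleAlg.run_congr D.V hagree]
    exact h.1
  · rw [OracleAlg.queries_congr D.V hagree] at hu
    exact (h.2 u hu).imp (fun h' => hle.1 h') (fun h' => hle.2 h')

/-- **Transfer of an accepting run to a condition.** If the verifier accepts `z` relative to a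
set `S` meeting `σ`, then the extension of `σ` by the verdicts of `S` on the queries of that run
forces `z ∈ K'` (Wilson: put the queried strings of an accepting computation into `B` resp.
reserve them for `B̄`). [cite: Wilson1985, Lemma 2 (proof, p. 174, step (a₁))] -/
theorem vYes_extendBy {σ : Cond} {S : Set (List Bool)} (hS : Meets S σ) {z : List Bool}
    (hrun : D.V.run (Oracle.ofLanguage S) (D.qV.eval z.length) z = some true) :
    VYes D (σ.extendBy (D.V.queries (Oracle.ofLanguage S) (D.qV.eval z.length) z).toFinset S) z := by
  set Q := (D.V.queries (Oracle.ofLanguage S) (D.qV.eval z.length) z).toFinset with hQ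
  have hagree : ∀ u ∈ D.V.queries (Oracle.ofLanguage S) (D.qV.eval z.length) z,
      Oracle.ofLanguage (σ.extendBy Q S).lang u = Oracle.ofLanguage S u := by
    intro u hu
    refine Oracle.ofLanguage_apply_eq_of_iff ?_
    exact Cond.mem_extendBy_I_iff_of_mem hS (List.mem_toFinset.2 hu)
  refine ⟨?_, fun u hu => ?_⟩
  · rw [OracleAlg.run_congr D.V hagree]
    exact hrun
  · rw [OracleAlg.queries_congr D.V hagree] at hu
    by_cases huS : u ∈ S
    · exact Or.inl ((Cond.mem_extendBy_I_iff_of_mem hS (List.mem_toFinset.2 hu)).2 huS)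
    · exact Or.inr (Cond.mem_extendBy_O.2 (Or.inr ⟨List.mem_toFinset.2 hu, huS⟩))

/-- A forced `y ∉ K` persists relative to every set meeting the condition: an accepting run
relative to `S` would transfer to a disjoint extension forcing `y ∈ K` (Wilson: "further
changes to `B` cannot cause any `NM_j^B` to change its behavior on `y`").
[cite: Wilson1985, Lemma 2 (proof, p. 174, step (b))] -/
theorem KNo.not_mem_Kset {σ : Cond} {y : List Bool} (h : KNo D σ y) (hσ : σ.Disj)
    {S : Set (List Bool)} (hS : Meets S σ) : y ∉ D.Kset S := by
  rintro ⟨w, hw, hrun⟩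
  refine h _ (σ.le_extendBy _ S) (Cond.extendBy_disj hσ hS _) ⟨w, hw, vYes_extendBy hS hrun⟩

/-- The dichotomy decides membership in `K(S)` for every set meeting the condition. [cite: Wilson1985, Lemma 2 (proof, p. 174)] -/
theorem mem_Kset_iff_of_decided {σ : Cond} {y : List Bool} (h : KYes D σ y ∨ KNo D σ y)
    (hσ : σ.Disj) {S : Set (List Bool)} (hS : Meets S σ) : y ∈ D.Kset S ↔ KYes D σ y := by
  rcases h with h | h
  · exact ⟨fun _ => h, fun _ => h.mem_Kset hσ hS⟩
  · exact ⟨fun hy => absurd hy (h.not_mem_Kset hσ hS), fun hK => absurd hK (h σ le_rfl hσ)⟩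

/-- **Every condition has an extension deciding `y`**, disjoint if the condition is, with at most
`vb |y|` new commitments: either some disjoint extension forces `y ∈ K` — then transfer its
accepting run onto `σ` (at most `q_V |⟨y, w⟩| ≤ vb |y|` queried strings) — or `σ` already forces
`y ∉ K`. (Wilson, step (a₁): "If there are at most `m` of these strings which, when added to `B`,
will cause `NM_j^B` to accept `y` within `m` steps, then we place these strings in `B` ...".)
[cite: Wilson1985, Lemma 2 (proof, p. 174, step (a₁))] -/
theorem exists_decide (D : Descr) (σ : Cond) (y : List Bool) :
    ∃ τ : Cond, σ ≤ τ ∧ (σ.Disj → τ.Disj) ∧ (KYes D τ y ∨ KNo D τ y) ∧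
      τ.committed.card ≤ σ.committed.card + D.vb y.length := by
  by_cases h : ∃ τ : Cond, σ ≤ τ ∧ τ.Disj ∧ KYes D τ y
  · obtain ⟨τ₀, hle, hτ₀, w, hw, hV⟩ := h
    have hS : Meets τ₀.lang σ := (meets_lang hτ₀).anti hle
    set z := boolPair y w with hz
    set Q := (D.V.queries (Oracle.ofLanguage τ₀.lang) (D.qV.eval z.length) z).toFinset with hQ
    refine ⟨σ.extendBy Q τ₀.lang, σ.le_extendBy Q _, fun hσ => Cond.extendBy_disj hσ hS Q,
      Or.inl ⟨w, hw, vYes_extendBy hS hV.1⟩, ?_⟩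
    calc (σ.extendBy Q τ₀.lang).committed.card ≤ (σ.committed ∪ Q).card :=
          Finset.card_le_card (σ.committed_extendBy_subset Q _)
      _ ≤ σ.committed.card + Q.card := Finset.card_union_le _ _
      _ ≤ σ.committed.card + D.vb y.length := by
          refine Nat.add_le_add_left ?_ _
          refine (List.toFinset_card_le _).trans ((D.V.length_queries_le _ _ _).trans ?_)
          refine TM2Iter.eval_mono _ ?_
          rw [hz, length_boolPair]
          omega
  · refine ⟨σ, le_rfl, id, Or.inr fun τ hle hτ hK => h ⟨τ, hle, hτ, hK⟩, Nat.le_add_right _ _⟩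

/-- **The deciding extension** of `σ` for the query `y` (a choice of the extension of
`exists_decide`). [cite: Wilson1985, Lemma 2 (proof, p. 174, step (a₁))] -/
noncomputable def decideK (D : Descr) (σ : Cond) (y : List Bool) : Cond :=
  Classical.choose (exists_decide D σ y)

/-- `decideK` extends. [folklore] -/
theorem le_decideK (D : Descr) (σ : Cond) (y : List Bool) : σ ≤ decideK D σ y :=
  (Classical.choose_spec (exists_decide D σ y)).1

/-- `decideK` preserves disjointness. [folklore] -/
theorem decideK_disj (D : Descr) {σ : Cond} (hσ : σ.Disj) (y : List Bool) : (decideK D σ y).Disj :=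
  (Classical.choose_spec (exists_decide D σ y)).2.1 hσ

/-- `decideK` decides. [cite: Wilson1985, Lemma 2 (proof, p. 174)] -/
theorem decideK_decides (D : Descr) (σ : Cond) (y : List Bool) :
    KYes D (decideK D σ y) y ∨ KNo D (decideK D σ y) y :=
  (Classical.choose_spec (exists_decide D σ y)).2.2.1

/-- `decideK` commits at most `vb |y|` new strings. [cite: Wilson1985, Lemma 2 (proof, p. 174)] -/
theorem card_decideK_le (D : Descr) (σ : Cond) (y : List Bool) :
    (decideK D σ y).committed.card ≤ σ.committed.card + D.vb y.length :=
  (Classical.choose_spec (exists_decide D σ y)).2.2.2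

/-- The answer bit recorded for the query `y` at the deciding extension. [cite: Wilson1985, Lemma 2 (proof, p. 174: "answer the query appropriately")] -/
noncomputable def kbit (D : Descr) (τ : Cond) (y : List Bool) : Bool :=
  haveI := Classical.dec (KYes D τ y)
  decide (KYes D τ y)

/-- The recorded bit is `true` iff `y ∈ K` is forced. [folklore] -/
theorem kbit_eq_true_iff {D : Descr} {τ : Cond} {y : List Bool} : kbit D τ y = true ↔ KYes D τ y := by
  unfold kbit
  exact @decide_eq_true_iff _ (Classical.dec _)

/-! ### Simulating the `P^K` machine -/

/-- **The simulation** of `M` on `x` from the condition `σ` with partial transcript `ans` for at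
most `k` more rounds: each query `y` (of length `≤ q |x|`; a longer query aborts the simulation)
is decided by `decideK` and answered by the forced bit; the result is the final condition and
the output, if any (Wilson, Stage `N`, step 1 (a₀)–(b)). [cite: Wilson1985, Lemma 2 (proof, p. 174, step 1)] -/
noncomputable def sim (D : Descr) (x : List Bool) : ℕ → Cond → List (List Bool) → Cond × Option Bool
  | 0, σ, _ => (σ, none)
  | k + 1, σ, ans =>
    match D.M.step x ans with
    | Sum.inr b => (σ, some b)
    | Sum.inl y =>
      if y.length ≤ D.q.eval x.length then
        sim D x k (decideK D σ y) (ans ++ [encodeBool (kbit D (decideK D σ y) y)])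
      else (σ, none)

/-- The simulation only extends the condition. [folklore] -/
theorem le_sim (D : Descr) (x : List Bool) :
    ∀ (k : ℕ) (σ : Cond) (ans : List (List Bool)), σ ≤ (sim D x k σ ans).1
  | 0, _, _ => le_rfl
  | k + 1, σ, ans => by
    unfold sim
    cases D.M.step x ans with
    | inr b => exact le_rfl
    | inl y =>
      dsimp only
      split_ifs with h
      · exact (le_decideK D σ y).trans (le_sim D x k _ _)
      · exact le_rfl

/-- The simulation preserves disjointness. [folklore] -/
theorem sim_disj (D : Descr) (x : List Bool) :
    ∀ (k : ℕ) {σ : Cond} (_ : σ.Disj) (ans : List (List Bool)), (sim D x k σ ans).1.Disj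
  | 0, _, hσ, _ => hσ
  | k + 1, σ, hσ, ans => by
    unfold sim
    cases D.M.step x ans with
    | inr b => exact hσ
    | inl y =>
      dsimp only
      split_ifs with h
      · exact sim_disj D x k (decideK_disj D hσ y) _
      · exact hσ

/-- **Counting the commitments of a simulation**: at most `vb (q |x|)` per round.
[cite: Wilson1985, Lemma 2 (proof, p. 174: "at most `T(N)` strings to be reserved")] -/
theorem card_sim_le (D : Descr) (x : List Bool) :
    ∀ (k : ℕ) (σ : Cond) (ans : List (List Bool)),
      (sim D x k σ ans).1.committed.card ≤ σ.committed.card + k * D.vb (D.q.eval x.length)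
  | 0, _, _ => Nat.le_add_right _ _
  | k + 1, σ, ans => by
    unfold sim
    cases D.M.step x ans with
    | inr b => exact Nat.le_add_right _ _
    | inl y =>
      dsimp only
      split_ifs with h
      · calc (sim D x k (decideK D σ y) _).1.committed.card
            ≤ (decideK D σ y).committed.card + k * D.vb (D.q.eval x.length) := card_sim_le D x k _ _
          _ ≤ σ.committed.card + D.vb y.length + k * D.vb (D.q.eval x.length) :=
              Nat.add_le_add_right (card_decideK_le D σ y) _
          _ ≤ σ.committed.card + D.vb (D.q.eval x.length) + k * D.vb (D.q.eval x.length) :=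
              Nat.add_le_add_right (Nat.add_le_add_left (D.vb_mono h) _) _
          _ = σ.committed.card + (k + 1) * D.vb (D.q.eval x.length) := by ring
      · exact Nat.le_add_right _ _

/-- **The simulation theorem.** Let `S` meet the final condition of the simulation from a
disjoint `σ`. If the true run of `M` relative to `K(S)` (continued from `ans`) asks only queries
of length `≤ q |x|`, then it IS the simulated run: every answer given by the simulation is the
true answer relative to `K(S)` (`mem_Kset_iff_of_decided`, as `S` meets every intermediate
condition). (Wilson: "`M_i^{K(B)}` accepts `x` within its time bound. Furthermore, no change to
the oracle that could be made in later stages can alter the behavior of `M_i^{K(B)}` on `x` as we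
have fixed the queries made to `K(B)`.") [cite: Wilson1985, Lemma 2 (proof, p. 174)] -/
theorem runAux_eq_sim (D : Descr) (x : List Bool) {S : Set (List Bool)} :
    ∀ (k : ℕ) {σ : Cond} (_ : σ.Disj) (ans : List (List Bool)),
      Meets S (sim D x k σ ans).1 →
      (∀ y ∈ D.M.queriesAux (Oracle.ofLanguage (D.Kset S)) x k ans, y.length ≤ D.q.eval x.length) →
      D.M.runAux (Oracle.ofLanguage (D.Kset S)) x k ans = (sim D x k σ ans).2
  | 0, _, _, _, _, _ => rfl
  | k + 1, σ, hσ, ans, hS, hq => by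
    unfold sim at hS ⊢
    rw [OracleAlg.runAux_succ]
    unfold OracleAlg.queriesAux at hq
    cases hstep : D.M.step x ans with
    | inr b => rfl
    | inl y =>
      simp only [hstep] at hS hq ⊢
      have hy : y.length ≤ D.q.eval x.length := hq y (List.mem_cons_self)
      rw [if_pos hy] at hS ⊢
      set τ := decideK D σ y with hτ
      have hτd : τ.Disj := decideK_disj D hσ y
      have hSτ : Meets S τ := hS.anti (le_sim D x k τ _)
      have hans : Oracle.ofLanguage (D.Kset S) y = encodeBool (kbit D τ y) := by
        rw [Oracle.ofLanguage_apply]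
        congr 1
        have hiff := mem_Kset_iff_of_decided (decideK_decides D σ y) hτd hSτ
        rcases Bool.eq_false_or_eq_true (kbit D τ y) with hb | hb
        · rw [hb]
          exact (Set.mem_iff_boolIndicator _ _).1 (hiff.2 (kbit_eq_true_iff.1 hb))
        · rw [hb]
          refine (Set.notMem_iff_boolIndicator _ _).1 fun hmem => ?_
          have := kbit_eq_true_iff.2 (hiff.1 hmem)
          rw [hb] at this
          exact Bool.false_ne_true this
      rw [hans] at hq ⊢
      exact runAux_eq_sim D x k hτd _ hS fun y' hy' => hq y' (List.mem_cons_of_mem y hy')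

/-! ### Processing one input -/

/-- **Processing the input `x` of the description `D`** from the condition `σ`: simulate `M` on
`x` for its full budget `q |x|` and record the verdict bit ("If `M_i^{K(B)}` now accepts `x`, put
`⟨i, x⟩` into `S₁`. Otherwise, put `⟨i, x⟩` into `S₀`"). [cite: Wilson1985, Lemma 2 (proof, p. 174, step (b))] -/
noncomputable def process (D : Descr) (x : List Bool) (σ : Cond) : Cond × Bool :=
  ((sim D x (D.q.eval x.length) σ []).1,
    decide ((sim D x (D.q.eval x.length) σ []).2 = some true))

/-- Processing extends the condition. [folklore] -/
theorem le_process (D : Descr) (x : List Bool) (σ : Cond) : σ ≤ (process D x σ).1 :=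
  le_sim D x _ σ []

/-- Processing preserves disjointness. [folklore] -/
theorem process_disj (D : Descr) (x : List Bool) {σ : Cond} (hσ : σ.Disj) : (process D x σ).1.Disj :=
  sim_disj D x _ hσ []

/-- Processing commits at most `cost |x|` new strings. [cite: Wilson1985, Lemma 2 (proof, p. 174)] -/
theorem card_process_le (D : Descr) (x : List Bool) (σ : Cond) :
    (process D x σ).1.committed.card ≤ σ.committed.card + D.cost x.length :=
  card_sim_le D x _ σ []

/-- **The recorded bit is correct.** If `S` meets the condition after processing `x` from a
disjoint `σ`, and relative to `K(S)` the machine `M` decides membership of `x` in `L` within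
`q |x|` rounds with queries of length `≤ q |x|` (as it does when `(M, q)` witnesses
`L ∈ P^{K(S)}`), then the recorded bit is `[x ∈ L]`. [cite: Wilson1985, Lemma 2 (proof, p. 174: "`x ∈ L ⇔ M_i^{K(B)}` accepts `x` ... `⇔ ⟨i, x⟩ ∈ S₁`")] -/
theorem process_eq_indicator (D : Descr) (x : List Bool) {σ : Cond} (hσ : σ.Disj)
    {S : Set (List Bool)} (hS : Meets S (process D x σ).1) {L : Language Bool}
    (hrun : D.M.run (Oracle.ofLanguage (D.Kset S)) (D.q.eval x.length) x = some (L.boolIndicator x))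
    (hq : ∀ y ∈ D.M.queries (Oracle.ofLanguage (D.Kset S)) (D.q.eval x.length) x,
      y.length ≤ D.q.eval x.length) :
    (process D x σ).2 = L.boolIndicator x := by
  have h := runAux_eq_sim D x (D.q.eval x.length) hσ [] hS hq
  change D.M.run _ _ x = _ at h
  rw [hrun] at h
  unfold process
  rw [← h]
  cases L.boolIndicator x <;> simp

/-! ### Genuine descriptions -/

/-- **`D` describes `L` relative to `S`**: `(V, q_V)` decides some `K' ∈ P^S`, `K` is its
`p`-bounded projection, and `(M, q)` decides `L ∈ P^K` — the unfolding of `L ∈ PRelClass (NPRel S)`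
along `D`. [cite: Wilson1985, §2 (p. 171: `Δ₂^{P,X} = ⋃_{Y ∈ NP^X} P^Y`) and Lemma 2] -/
structure Descr.Describes (D : Descr) (S : Set (List Bool)) (L : Language Bool) : Prop where
  /-- `M` decides `L` relative to `K(S)` within `q |x|` rounds -/
  run_eq : ∀ x : List Bool,
    D.M.run (Oracle.ofLanguage (D.Kset S)) (D.q.eval x.length) x = some (L.boolIndicator x)
  /-- with queries of length `≤ q |x|` -/
  queries_short : ∀ x : List Bool, ∀ y ∈ D.M.queries (Oracle.ofLanguage (D.Kset S)) (D.q.eval x.length) x,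
    y.length ≤ D.q.eval x.length

/-- **Unfolding `Δ₂^{P,S}` into descriptions**: every `L ∈ P^{NP^S}` (`PRelClass (NPRel S)`) is
described by some `D` whose two algorithms are polynomial-time. [cite: Wilson1985, §2 (p. 171) and Lemma 2 (proof, p. 173)] -/
theorem exists_describes {S : Set (List Bool)} {L : Language Bool}
    (hL : L ∈ PRelClass (NPRel (Oracle.ofLanguage S))) :
    ∃ D : Descr, D.M.IsPolyTime encodingBoolBool ∧ D.V.IsPolyTime encodingBoolBool ∧
      D.Describes S L := by
  obtain ⟨K, hK, hLK⟩ := mem_PRelClass_iff.1 hL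
  obtain ⟨K', ⟨V, hV, qV, hVq⟩, p, hKp⟩ := hK
  obtain ⟨M, hM, q, hMq⟩ := hLK
  let D : Descr := ⟨M, q, V, qV, p⟩
  have hK' : D.Kprime S = K' := by
    ext z
    change V.run (Oracle.ofLanguage S) (qV.eval z.length) z = some true ↔ z ∈ K'
    rw [(hVq z).1, Option.some.injEq, ← Set.mem_iff_boolIndicator]
    exact Iff.rfl
  have hKs : D.Kset S = K := by
    ext y
    change (∃ w : List Bool, w.length ≤ p.eval y.length ∧ boolPair y w ∈ D.Kprime S) ↔ y ∈ K
    rw [hK', hKp y]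
    exact Iff.rfl
  refine ⟨D, hM, hV, ⟨fun x => ?_, fun x => ?_⟩⟩
  · rw [hKs]
    exact (hMq x).1
  · rw [hKs]
    exact (hMq x).2

/-- For a genuine description the recorded bit is `[x ∈ L]`, from any disjoint condition whose
processed extension is met by the oracle set. [cite: Wilson1985, Lemma 2 (proof, p. 174)] -/
theorem Descr.Describes.process_eq {D : Descr} {S : Set (List Bool)} {L : Language Bool}
    (h : D.Describes S L) (x : List Bool) {σ : Cond} (hσ : σ.Disj)
    (hS : Meets S (process D x σ).1) : (process D x σ).2 = L.boolIndicator x :=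
  process_eq_indicator D x hσ hS (h.run_eq x) (h.queries_short x)


/-! ### The clock `T(s) = s^{log s}` -/

/-- The exponent `(log₂ s)²` of the clock. [cite: Wilson1985, Thm. 3.1 (proof, p. 175: `T(n) = n^{log n}`)] -/
def clockExp (s : ℕ) : ℕ :=
  Nat.log 2 s ^ 2

/-- **The clock** `T(s) = 2^{(log₂ s)²} = s^{log₂ s}`, a superpolynomial time-constructible bound.
[cite: Wilson1985, Thm. 3.1 (proof, p. 175)] -/
def clock (s : ℕ) : ℕ :=
  2 ^ clockExp s

/-- The clock exponent is monotone. [folklore] -/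
theorem clockExp_mono : Monotone clockExp :=
  fun _ _ h => Nat.pow_le_pow_left (Nat.log_mono_right h) 2

/-- The clock is monotone. [folklore] -/
theorem clock_mono : Monotone clock :=
  fun _ _ h => Nat.pow_le_pow_right Nat.two_pos (clockExp_mono h)

/-- The clock is positive. [folklore] -/
theorem one_le_clock (s : ℕ) : 1 ≤ clock s :=
  Nat.one_le_two_pow

/-- **Every polynomial is eventually below the clock** (`T(poly) ⊇ poly` for a superpolynomial
`T`: with `L = log₂ n ≥ max (k + 2) (c + 1)` one has `c n^k + c < 2^{L + k(L+1) + 1} ≤ 2^{L²}`).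
[cite: Wilson1985, §2 (p. 171) and Thm. 3.1 (proof, p. 175)] -/
theorem exists_eval_lt_clock (P : Polynomial ℕ) : ∃ N : ℕ, ∀ n, N ≤ n → P.eval n < clock n := by
  obtain ⟨c, k, hck⟩ := exists_eval_le_mul_pow_add P
  refine ⟨2 ^ max (k + 2) (c + 1), fun n hn => ?_⟩
  set L := Nat.log 2 n with hL
  have hLge : max (k + 2) (c + 1) ≤ L := Nat.le_log_of_pow_le one_lt_two hn
  have hk : k + 2 ≤ L := le_of_max_le_left hLge
  have hc : c + 1 ≤ L := le_of_max_le_right hLge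
  have hnlt : n < 2 ^ (L + 1) := Nat.lt_pow_succ_log_self one_lt_two n
  have hnk : n ^ k ≤ 2 ^ ((L + 1) * k) := by
    rw [pow_mul]
    exact Nat.pow_le_pow_left hnlt.le k
  have hcL : c < 2 ^ L := c.lt_two_pow_self.trans_le (Nat.pow_le_pow_right Nat.two_pos (by omega))
  have hexp : L + ((L + 1) * k + 1) ≤ L ^ 2 := by
    have : (k + 2) * L ≤ L * L := Nat.mul_le_mul_right L hk
    nlinarith
  calc P.eval n ≤ c * n ^ k + c := hck n
    _ ≤ c * (n ^ k + 1) := by ring_nf; exact le_rfl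
    _ ≤ c * (2 ^ ((L + 1) * k) + 1) := Nat.mul_le_mul_left c (Nat.add_le_add_right hnk 1)
    _ ≤ c * 2 ^ ((L + 1) * k + 1) := by
        refine Nat.mul_le_mul_left c ?_
        rw [pow_succ]
        have := Nat.one_le_two_pow (n := (L + 1) * k)
        omega
    _ < 2 ^ L * 2 ^ ((L + 1) * k + 1) := Nat.mul_lt_mul_of_pos_right hcL (Nat.two_pow_pos _)
    _ = 2 ^ (L + ((L + 1) * k + 1)) := (pow_add _ _ _).symm
    _ ≤ 2 ^ L ^ 2 := Nat.pow_le_pow_right Nat.two_pos hexp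
    _ = clock n := rfl

/-- The commitment budget of a description is polynomially bounded. [folklore] -/
theorem Descr.exists_cost_le (D : Descr) : ∃ P : Polynomial ℕ, ∀ n, D.cost n ≤ P.eval n := by
  refine ⟨D.q * D.qV.comp (Polynomial.C 2 * D.q + Polynomial.C 2 + D.p.comp D.q), fun n => ?_⟩
  simp only [Descr.cost, Descr.vb, Polynomial.eval_mul, Polynomial.eval_comp, Polynomial.eval_add,
    Polynomial.eval_C]
  exact le_rfl

/-- **The clock eventually affords every description**: `cost_D(n) < T(n)` for all large `n`.
[cite: Wilson1985, §2 (p. 171: time bounds hold "for sufficiently large `n`")] -/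
theorem Descr.exists_cost_lt_clock (D : Descr) : ∃ N : ℕ, ∀ n, N ≤ n → D.cost n < clock n := by
  obtain ⟨P, hP⟩ := D.exists_cost_le
  obtain ⟨N, hN⟩ := exists_eval_lt_clock P
  exact ⟨N, fun n hn => (hP n).trans_lt (hN n hn)⟩

/-! ### The schedule -/

variable (e : ℕ → Descr)

/-- Some stage `s ≥ max d n` affords the block `(d, n)`. [folklore] -/
theorem exists_stage_affording (d n : ℕ) : ∃ s : ℕ, max d n ≤ s ∧ (e d).cost n < clock s := by
  obtain ⟨N, hN⟩ := exists_eval_lt_clock (Polynomial.C ((e d).cost n))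
  refine ⟨max (max d n) N, le_max_left _ _, ?_⟩
  have := hN (max (max d n) N) (le_max_right _ _)
  rwa [Polynomial.eval_C] at this

/-- **The schedule**: the block of all inputs of length `n` of description number `d` is
processed at the least stage `s ≥ max d n` whose clock affords it, `cost_d(n) < T(s)`.
(Wilson indexes stages by the time bound `N = c_i n^{k_i}` of `⟨i, x⟩`; the scheduling by an
explicit clock is the transcript-model rendering of "`M_i` ... with time bounded by `T(c_i n^{k_i})`".)
[cite: Wilson1985, Lemma 2 (proof, pp. 173–174)] -/
noncomputable def sched (d n : ℕ) : ℕ :=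
  Nat.find (exists_stage_affording e d n)

/-- The defining property of the scheduled stage. [folklore] -/
theorem sched_spec (d n : ℕ) :
    max d n ≤ sched e d n ∧ (e d).cost n < clock (sched e d n) :=
  Nat.find_spec (exists_stage_affording e d n)

/-- `d ≤ sched e d n`. [folklore] -/
theorem le_sched_left (d n : ℕ) : d ≤ sched e d n :=
  (le_max_left d n).trans (sched_spec e d n).1

/-- `n ≤ sched e d n`. [folklore] -/
theorem le_sched_right (d n : ℕ) : n ≤ sched e d n :=
  (le_max_right d n).trans (sched_spec e d n).1

/-- Minimality of the scheduled stage. [folklore] -/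
theorem sched_le_of {d n s : ℕ} (h : max d n ≤ s ∧ (e d).cost n < clock s) : sched e d n ≤ s :=
  Nat.find_min' _ h

/-- A block whose own length affords it is scheduled at its length. [folklore] -/
theorem sched_eq_self {d n : ℕ} (hdn : d ≤ n) (hc : (e d).cost n < clock n) : sched e d n = n :=
  le_antisymm (sched_le_of e ⟨max_le hdn le_rfl, hc⟩) (le_sched_right e d n)

/-- **All large blocks of a description are scheduled at their own length.**
[cite: Wilson1985, §2 (p. 171) and Lemma 2 (proof, p. 174)] -/
theorem exists_sched_eq_self (d : ℕ) : ∃ N : ℕ, ∀ n, N ≤ n → sched e d n = n := by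
  obtain ⟨N, hN⟩ := (e d).exists_cost_lt_clock
  exact ⟨max N d, fun n hn => sched_eq_self e (le_of_max_le_right hn) (hN n (le_of_max_le_left hn))⟩

/-! ### All strings of a length; the blocks of a stage -/

/-- The list of all bit strings of length `n`. [folklore] -/
def allStr : ℕ → List (List Bool)
  | 0 => [[]]
  | n + 1 => (allStr n).flatMap fun x => [false :: x, true :: x]

/-- `allStr n` lists exactly the strings of length `n`. [folklore] -/
theorem mem_allStr_iff {n : ℕ} {x : List Bool} : x ∈ allStr n ↔ x.length = n := by
  induction n generalizing x with
  | zero => cases x <;> simp [allStr]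
  | succ n ih =>
    simp only [allStr, List.mem_flatMap, List.mem_cons, List.not_mem_nil, or_false]
    constructor
    · rintro ⟨y, hy, rfl | rfl⟩ <;> simp [ih.1 hy]
    · intro hx
      cases x with
      | nil => simp at hx
      | cons b y =>
        refine ⟨y, ih.2 (by simpa using hx), ?_⟩
        cases b <;> simp

/-- A `flatMap` whose pieces have bounded length has bounded length. [folklore] -/
theorem length_flatMap_le {α β : Type} (l : List α) (f : α → List β) (c : ℕ)
    (h : ∀ a ∈ l, (f a).length ≤ c) : (l.flatMap f).length ≤ l.length * c := by
  induction l with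
  | nil => simp
  | cons a l ih =>
    simp only [List.flatMap_cons, List.length_append, List.length_cons]
    have h1 := h a List.mem_cons_self
    have h2 := ih fun a' ha' => h a' (List.mem_cons_of_mem a ha')
    nlinarith

/-- There are `2ⁿ` strings of length `n`. [folklore] -/
theorem length_allStr (n : ℕ) : (allStr n).length = 2 ^ n := by
  induction n with
  | zero => rfl
  | succ n ih =>
    have : ∀ l : List (List Bool),
        (l.flatMap fun x => [false :: x, true :: x]).length = l.length * 2 := by
      intro l
      induction l with
      | nil => rfl
      | cons a l ihl => simp only [List.flatMap_cons, List.length_append, ihl]; simp; ring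
    change (List.flatMap _ (allStr n)).length = _
    rw [this, ih, pow_succ]

/-- **The blocks of stage `s`**: all pairs `(d, x)` with `sched e d |x| = s` (necessarily
`d, |x| ≤ s`), listed by `d`, then by length, then lexicographically.
[cite: Wilson1985, Lemma 2 (proof, p. 174, Stage N, Step 1: "Examine each `⟨i, x⟩` ... where `c_i n^{k_i} = N`")] -/
noncomputable def blockList (s : ℕ) : List (ℕ × List Bool) :=
  (List.range (s + 1)).flatMap fun d =>
    (List.range (s + 1)).flatMap fun n =>
      if sched e d n = s then (allStr n).map (Prod.mk d) else []

/-- Membership in the block list. [folklore] -/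
theorem mem_blockList_iff {s d : ℕ} {x : List Bool} :
    (d, x) ∈ blockList e s ↔ sched e d x.length = s := by
  unfold blockList
  simp only [List.mem_flatMap, List.mem_range]
  constructor
  · rintro ⟨d', -, n, -, h⟩
    split_ifs at h with hs
    · simp only [List.mem_map, Prod.mk.injEq] at h
      obtain ⟨y, hy, rfl, rfl⟩ := h
      rwa [mem_allStr_iff.1 hy]
    · simp at h
  · intro h
    refine ⟨d, ?_, x.length, ?_, ?_⟩
    · have := le_sched_left e d x.length
      omega
    · have := le_sched_right e d x.length
      omega
    · rw [if_pos h]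
      exact List.mem_map.2 ⟨x, mem_allStr_iff.2 rfl, rfl⟩

/-- The number of blocks-list entries of stage `s`: at most `(s+1)² 2^s`. [folklore] -/
def nb (s : ℕ) : ℕ :=
  (s + 1) * ((s + 1) * 2 ^ s)

/-- `nb` is monotone. [folklore] -/
theorem nb_mono : Monotone nb := by
  intro a b h
  unfold nb
  have := Nat.pow_le_pow_right Nat.two_pos h
  gcongr

/-- The block list of stage `s` has at most `nb s` entries. [cite: Wilson1985, Lemma 2 (proof, p. 174: "Each of the at most `2^{N+1}` strings `⟨i, x⟩`")] -/
theorem length_blockList_le (s : ℕ) : (blockList e s).length ≤ nb s := by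
  unfold blockList nb
  refine (length_flatMap_le _ _ _ fun d _ => ?_).trans (by rw [List.length_range])
  refine (length_flatMap_le _ _ _ fun n hn => ?_).trans (by rw [List.length_range])
  split_ifs
  · rw [List.length_map, length_allStr]
    exact Nat.pow_le_pow_right Nat.two_pos (Nat.lt_succ_iff.1 (List.mem_range.1 hn))
  · exact Nat.zero_le _

/-! ### Processing a list of pairs -/

/-- **Sequential processing** of a list of pairs `(d, x)` from a condition: process each pair in
turn (`Wilson.process`) from the condition left by its predecessors, recording the verdict bits.
[cite: Wilson1985, Lemma 2 (proof, p. 174, Step 1)] -/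
noncomputable def procList : List (ℕ × List Bool) → Cond → Cond × List ((ℕ × List Bool) × Bool)
  | [], σ => (σ, [])
  | dx :: rest, σ =>
    ((procList rest (process (e dx.1) dx.2 σ).1).1,
      (dx, (process (e dx.1) dx.2 σ).2) :: (procList rest (process (e dx.1) dx.2 σ).1).2)

/-- Sequential processing extends the condition. [folklore] -/
theorem le_procList : ∀ (l : List (ℕ × List Bool)) (σ : Cond), σ ≤ (procList e l σ).1
  | [], _ => le_rfl
  | dx :: rest, σ => (le_process (e dx.1) dx.2 σ).trans (le_procList rest _)

/-- Sequential processing preserves disjointness. [folklore] -/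
theorem procList_disj : ∀ (l : List (ℕ × List Bool)) {σ : Cond}, σ.Disj → (procList e l σ).1.Disj
  | [], _, hσ => hσ
  | dx :: rest, _, hσ => procList_disj rest (process_disj (e dx.1) dx.2 hσ)

/-- One verdict bit per entry. [folklore] -/
theorem length_procList : ∀ (l : List (ℕ × List Bool)) (σ : Cond), (procList e l σ).2.length = l.length
  | [], _ => rfl
  | _ :: rest, _ => by simp only [procList, List.length_cons, length_procList rest]

/-- **Counting**: processing a list whose entries cost at most `c` each commits at most
`|l| · c` new strings. [cite: Wilson1985, Lemma 2 (proof, pp. 174–175)] -/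
theorem card_procList_le : ∀ (l : List (ℕ × List Bool)) (σ : Cond) (c : ℕ),
    (∀ dx ∈ l, (e dx.1).cost dx.2.length ≤ c) →
      (procList e l σ).1.committed.card ≤ σ.committed.card + l.length * c
  | [], _, _, _ => Nat.le_add_right _ _
  | dx :: rest, σ, c, h => by
    simp only [procList, List.length_cons]
    calc (procList e rest (process (e dx.1) dx.2 σ).1).1.committed.card
        ≤ (process (e dx.1) dx.2 σ).1.committed.card + rest.length * c :=
          card_procList_le rest _ c fun dx' h' => h dx' (List.mem_cons_of_mem dx h')
      _ ≤ σ.committed.card + c + rest.length * c :=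
          Nat.add_le_add_right ((card_process_le _ _ _).trans (Nat.add_le_add_left (h dx List.mem_cons_self) _)) _
      _ = σ.committed.card + (rest.length + 1) * c := by ring

/-- Every recorded entry comes from processing its pair at some intermediate condition, whose
result condition lies below the final one. [folklore] -/
theorem mem_procList : ∀ (l : List (ℕ × List Bool)) (σ : Cond) {dx : ℕ × List Bool} {b : Bool},
    (dx, b) ∈ (procList e l σ).2 →
      ∃ σ₁ : Cond, σ ≤ σ₁ ∧ (σ.Disj → σ₁.Disj) ∧ (process (e dx.1) dx.2 σ₁).2 = b ∧
        (process (e dx.1) dx.2 σ₁).1 ≤ (procList e l σ).1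
  | [], _, _, _, h => by simp [procList] at h
  | dx₀ :: rest, σ, dx, b, h => by
    simp only [procList, List.mem_cons, Prod.mk.injEq] at h
    rcases h with ⟨rfl, rfl⟩ | h
    · exact ⟨σ, le_rfl, id, rfl, le_procList e rest _⟩
    · obtain ⟨σ₁, hle, hdisj, hb, hfin⟩ := mem_procList rest _ h
      exact ⟨σ₁, (le_process _ _ σ).trans hle, fun hσ => hdisj (process_disj _ _ hσ), hb, hfin⟩

/-- Every listed pair gets an entry. [folklore] -/
theorem exists_mem_procList : ∀ (l : List (ℕ × List Bool)) (σ : Cond) {dx : ℕ × List Bool},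
    dx ∈ l → ∃ b : Bool, (dx, b) ∈ (procList e l σ).2
  | [], _, _, h => absurd h List.not_mem_nil
  | dx₀ :: rest, σ, dx, h => by
    simp only [procList, List.mem_cons, Prod.mk.injEq]
    rcases List.mem_cons.1 h with rfl | h
    · exact ⟨_, Or.inl ⟨rfl, rfl⟩⟩
    · obtain ⟨b, hb⟩ := exists_mem_procList rest (process (e dx₀.1) dx₀.2 σ).1 h
      exact ⟨b, Or.inr hb⟩

/-! ### Codes and fresh suffixes -/

/-- **The code** `1^d 0 x α` of the pair `(d, x)` with the stage suffix `α` (Wilson's query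
string `⟨i, x⟩α`: "`i` and `α` will be hardwired into the circuit and `x` will be the input").
[cite: Wilson1985, Lemma 2 (proof, p. 173 and Fig. 1)] -/
def code (d : ℕ) (x α : List Bool) : List Bool :=
  List.replicate d true ++ false :: (x ++ α)

/-- The length of a code: `d + 1 + |x| + |α|`. [cite: Wilson1985, Lemma 2 (proof, p. 175: "The size of the circuit `⟨i, x⟩α` is `n + |α|`")] -/
theorem length_code (d : ℕ) (x α : List Bool) :
    (code d x α).length = d + 1 + x.length + α.length := by
  simp only [code, List.length_append, List.length_replicate, List.length_cons]
  omega

/-- Unary prefixes are uniquely decodable. [folklore] -/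
theorem replicate_append_cons_inj : ∀ {d d' : ℕ} {u u' : List Bool},
    List.replicate d true ++ false :: u = List.replicate d' true ++ false :: u' → d = d' ∧ u = u'
  | 0, 0, _, _, h => ⟨rfl, by simpa using h⟩
  | 0, _ + 1, _, _, h => by simp [List.replicate_succ] at h
  | _ + 1, 0, _, _, h => by simp [List.replicate_succ] at h
  | d + 1, d' + 1, u, u', h => by
    simp only [List.replicate_succ, List.cons_append, List.cons.injEq, true_and] at h
    obtain ⟨h1, h2⟩ := replicate_append_cons_inj h
    exact ⟨by rw [h1], h2⟩

/-- **Codes with the same suffix are injective in the pair.** [folklore] -/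
theorem code_inj {d d' : ℕ} {x x' α : List Bool} (h : code d x α = code d' x' α) :
    d = d' ∧ x = x' := by
  obtain ⟨h1, h2⟩ := replicate_append_cons_inj h
  exact ⟨h1, List.append_cancel_right h2⟩

/-- The suffix of length `a` of a string (the whole string if shorter). [folklore] -/
def lastN (a : ℕ) (u : List Bool) : List Bool :=
  u.drop (u.length - a)

/-- The suffix of a code is its stage suffix. [folklore] -/
theorem lastN_code (d : ℕ) (x α : List Bool) : lastN α.length (code d x α) = α := by
  unfold lastN
  have : code d x α = (List.replicate d true ++ false :: x) ++ α := by simp [code]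
  rw [this, List.length_append, Nat.add_sub_cancel, List.drop_left]

/-- **A fresh suffix exists**: if fewer than `2^a` strings are committed, some string of length
`a` is the suffix of none of them. (Wilson, p. 175: "the total number of reserved strings is less
than ... `2^{log T(N) + N + 3}`. So there will always be an `α` satisfying the requirements of
Step 2.") [cite: Wilson1985, Lemma 2 (proof, p. 175)] -/
theorem exists_fresh (T : Finset (List Bool)) {a : ℕ} (h : T.card < 2 ^ a) :
    ∃ α : List Bool, α.length = a ∧ ∀ u ∈ T, lastN a u ≠ α := by
  classical
  by_contra hne
  push Not at hne
  let f : (Fin a → Bool) → List Bool := fun v => List.ofFn v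
  have hf : Function.Injective f := fun v w hvw => List.ofFn_injective hvw
  have hsub : Finset.univ.image f ⊆ T.image (lastN a) := by
    intro α hα
    obtain ⟨v, -, rfl⟩ := Finset.mem_image.1 hα
    obtain ⟨u, hu, hu'⟩ := hne (f v) (List.length_ofFn)
    exact Finset.mem_image.2 ⟨u, hu, hu'⟩
  have hcard : (Finset.univ.image f).card = 2 ^ a := by
    rw [Finset.card_image_of_injective _ hf, Finset.card_univ, Fintype.card_fun, Fintype.card_bool,
      Fintype.card_fin]
  have := (Finset.card_le_card hsub).trans Finset.card_image_le
  omega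

open Classical in
/-- **The fresh suffix** of length `a` for the committed set `T` (junk `0^a` if none exists).
[cite: Wilson1985, Lemma 2 (proof, p. 174, Step 2: "Choose an `α` ... such that no member of `S₁α` has been reserved")] -/
noncomputable def fresh (T : Finset (List Bool)) (a : ℕ) : List Bool :=
  if h : ∃ α : List Bool, α.length = a ∧ ∀ u ∈ T, lastN a u ≠ α then Classical.choose h
  else List.replicate a false

/-- The fresh suffix has the prescribed length. [folklore] -/
theorem length_fresh (T : Finset (List Bool)) (a : ℕ) : (fresh T a).length = a := by
  unfold fresh
  split_ifs with h
  · exact (Classical.choose_spec h).1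
  · exact List.length_replicate

/-- The fresh suffix is the suffix of no committed string. [cite: Wilson1985, Lemma 2 (proof, p. 175)] -/
theorem fresh_spec {T : Finset (List Bool)} {a : ℕ} (h : T.card < 2 ^ a) :
    ∀ u ∈ T, lastN a u ≠ fresh T a := by
  have hex := exists_fresh T h
  unfold fresh
  rw [dif_pos hex]
  exact (Classical.choose_spec hex).2

/-- **The suffix length** `a(s) = s + (log₂ s)² + 3 log₂(s+1) + 5` of stage `s` (Wilson:
`|α| = log T(N) + N + 3`). [cite: Wilson1985, Lemma 2 (proof, p. 174, Step 2)] -/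
def sufLen (s : ℕ) : ℕ :=
  s + clockExp s + 3 * Nat.log 2 (s + 1) + 5

/-! ### The stages -/

/-- The run of stage `s` from the condition `σ`: process the block list of `s`.
[cite: Wilson1985, Lemma 2 (proof, p. 174, Step 1)] -/
noncomputable def stageRun (s : ℕ) (σ : Cond) : Cond × List ((ℕ × List Bool) × Bool) :=
  procList e (blockList e s) σ

/-- The suffix chosen at stage `s` from `σ`: fresh for everything committed after the run.
[cite: Wilson1985, Lemma 2 (proof, p. 174, Step 2)] -/
noncomputable def stageAlpha (s : ℕ) (σ : Cond) : List Bool :=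
  fresh (stageRun e s σ).1.committed (sufLen s)

/-- The codes of the entries recorded with bit `b`. [cite: Wilson1985, Lemma 2 (proof, p. 174, Step 2: `S₁α`, `S₀α`)] -/
noncomputable def codesOf (α : List Bool) (res : List ((ℕ × List Bool) × Bool)) (b : Bool) :
    Finset (List Bool) :=
  ((res.filter fun r => r.2 == b).map fun r => code r.1.1 r.1.2 α).toFinset

/-- Membership in `codesOf`. [folklore] -/
theorem mem_codesOf_iff {α : List Bool} {res : List ((ℕ × List Bool) × Bool)} {b : Bool} {c : List Bool} :
    c ∈ codesOf α res b ↔ ∃ dx : ℕ × List Bool, (dx, b) ∈ res ∧ code dx.1 dx.2 α = c := by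
  unfold codesOf
  simp only [List.mem_toFinset, List.mem_map, List.mem_filter, beq_iff_eq]
  constructor
  · rintro ⟨⟨dx, b'⟩, ⟨h, rfl⟩, hc⟩
    exact ⟨dx, h, hc⟩
  · rintro ⟨dx, h, hc⟩
    exact ⟨(dx, b), ⟨h, rfl⟩, hc⟩

/-- There are at most as many codes as entries. [folklore] -/
theorem card_codesOf_le (α : List Bool) (res : List ((ℕ × List Bool) × Bool)) (b : Bool) :
    (codesOf α res b).card ≤ res.length := by
  unfold codesOf
  refine (List.toFinset_card_le _).trans ?_
  rw [List.length_map]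
  exact List.length_filter_le _ _

/-- **One stage** (Wilson, Stage `N`): run the block list, choose the fresh suffix `α`, commit
the codes of the accepted pairs IN and those of the rejected pairs OUT ("Put all of `S₁α` into
`B`, reserve all of `S₀α` for `B̄`"; a code recorded both ways — impossible for genuine
descriptions — goes IN). [cite: Wilson1985, Lemma 2 (proof, p. 174, Steps 1–2)] -/
noncomputable def stageNext (s : ℕ) (σ : Cond) : Cond :=
  ⟨(stageRun e s σ).1.I ∪ codesOf (stageAlpha e s σ) (stageRun e s σ).2 true,
    (stageRun e s σ).1.O ∪
      (codesOf (stageAlpha e s σ) (stageRun e s σ).2 false \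
        codesOf (stageAlpha e s σ) (stageRun e s σ).2 true)⟩

/-- **The condition reached before stage `s`** ("Stage 0. Initially, `B` is empty").
[cite: Wilson1985, Lemma 2 (proof, p. 174)] -/
noncomputable def stageCond : ℕ → Cond
  | 0 => Cond.empty
  | s + 1 => stageNext e s (stageCond s)

/-- **Wilson's oracle** `B = ⋃_s I_s`. [cite: Wilson1985, Lemma 2 and Thm. 3.1] -/
def oracle : Set (List Bool) :=
  {u | ∃ s : ℕ, u ∈ (stageCond e s).I}

/-- The suffix `α_s` of stage `s`. [cite: Wilson1985, Lemma 2 (proof, p. 174, Step 2)] -/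
noncomputable def alpha (s : ℕ) : List Bool :=
  stageAlpha e s (stageCond e s)

/-- The verdict bits recorded at stage `s` (Wilson's `S₁`, `S₀`). [cite: Wilson1985, Lemma 2 (proof, p. 174, Step 1 (b))] -/
noncomputable def results (s : ℕ) : List ((ℕ × List Bool) × Bool) :=
  (stageRun e s (stageCond e s)).2

/-- The condition after the run of stage `s`, before the codes are committed. [folklore] -/
noncomputable def midCond (s : ℕ) : Cond :=
  (stageRun e s (stageCond e s)).1

/-- Unfolding of the successor stage. [folklore] -/
theorem stageCond_succ (s : ℕ) : stageCond e (s + 1) = stageNext e s (stageCond e s) :=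
  rfl

/-- The suffix of stage `s` has length `a(s)`. [folklore] -/
theorem length_alpha (s : ℕ) : (alpha e s).length = sufLen s :=
  length_fresh _ _

/-- The run of a stage extends its starting condition. [folklore] -/
theorem stageCond_le_midCond (s : ℕ) : stageCond e s ≤ midCond e s :=
  le_procList e _ _

/-- Committing the codes extends the run's condition. [folklore] -/
theorem midCond_le_stageCond_succ (s : ℕ) : midCond e s ≤ stageCond e (s + 1) :=
  ⟨Finset.subset_union_left, Finset.subset_union_left⟩

/-- The stage conditions increase. [folklore] -/
theorem stageCond_le_succ (s : ℕ) : stageCond e s ≤ stageCond e (s + 1) :=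
  (stageCond_le_midCond e s).trans (midCond_le_stageCond_succ e s)

/-- The stage conditions are monotone. [folklore] -/
theorem stageCond_mono {s t : ℕ} (h : s ≤ t) : stageCond e s ≤ stageCond e t := by
  induction h with
  | refl => exact le_rfl
  | step _ ih => exact ih.trans (stageCond_le_succ e _)

/-! ### Counting the commitments -/

/-- The commitments of one stage: the runs plus the codes. [folklore] -/
def inc (s : ℕ) : ℕ :=
  nb s * clock s + 2 * nb s

/-- `inc` is monotone. [folklore] -/
theorem inc_mono : Monotone inc := by
  intro a b h
  unfold inc
  have h1 := nb_mono h
  have h2 := clock_mono h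
  gcongr

/-- The run of stage `s` commits at most `nb s · T(s)` new strings. [cite: Wilson1985, Lemma 2 (proof, pp. 174–175)] -/
theorem card_stageRun_le (s : ℕ) (σ : Cond) :
    (stageRun e s σ).1.committed.card ≤ σ.committed.card + nb s * clock s := by
  refine (card_procList_le e _ σ (clock s) fun dx hdx => ?_).trans ?_
  · obtain ⟨d, x⟩ := dx
    have h := (mem_blockList_iff e).1 hdx
    have := (sched_spec e d x.length).2
    rw [h] at this
    exact this.le
  · exact Nat.add_le_add_left (Nat.mul_le_mul_right _ (length_blockList_le e s)) _

/-- One stage commits at most `inc s` new strings. [cite: Wilson1985, Lemma 2 (proof, pp. 174–175)] -/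
theorem card_stageNext_le (s : ℕ) (σ : Cond) :
    (stageNext e s σ).committed.card ≤ σ.committed.card + inc s := by
  have hres : (stageRun e s σ).2.length ≤ nb s := by
    unfold stageRun
    rw [length_procList]
    exact length_blockList_le e s
  set α := stageAlpha e s σ with hα
  set T := codesOf α (stageRun e s σ).2 true with hT
  set F := codesOf α (stageRun e s σ).2 false with hF
  have hTc : T.card ≤ nb s := (card_codesOf_le _ _ _).trans hres
  have hFc : (F \ T).card ≤ nb s :=
    (Finset.card_le_card Finset.sdiff_subset).trans ((card_codesOf_le _ _ _).trans hres)
  have hrun := card_stageRun_le e s σ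
  have heq : (stageNext e s σ).committed =
      (stageRun e s σ).1.committed ∪ (T ∪ (F \ T)) := by
    unfold stageNext Cond.committed
    exact Finset.union_union_union_comm _ _ _ _
  rw [heq]
  calc ((stageRun e s σ).1.committed ∪ (T ∪ (F \ T))).card
      ≤ (stageRun e s σ).1.committed.card + (T ∪ (F \ T)).card := Finset.card_union_le _ _
    _ ≤ (stageRun e s σ).1.committed.card + (T.card + (F \ T).card) :=
        Nat.add_le_add_left (Finset.card_union_le _ _) _
    _ ≤ (σ.committed.card + nb s * clock s) + (nb s + nb s) :=
        Nat.add_le_add hrun (Nat.add_le_add hTc hFc)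
    _ = σ.committed.card + inc s := by unfold inc; ring

/-- **The commitments before stage `s`**: at most `s · inc s`. [cite: Wilson1985, Lemma 2 (proof, p. 175: the displayed count)] -/
theorem card_stageCond_le (s : ℕ) : (stageCond e s).committed.card ≤ s * inc s := by
  induction s with
  | zero => simp [stageCond, Cond.committed_empty]
  | succ s ih =>
    rw [stageCond_succ]
    calc (stageNext e s (stageCond e s)).committed.card
        ≤ (stageCond e s).committed.card + inc s := card_stageNext_le e s _
      _ ≤ s * inc s + inc s := Nat.add_le_add_right ih _
      _ = (s + 1) * inc s := by ring
      _ ≤ (s + 1) * inc (s + 1) := Nat.mul_le_mul_left _ (inc_mono (Nat.le_succ s))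

/-- The arithmetic of the suffix length: `(s+1) · inc s < 2^{a(s)}`. [cite: Wilson1985, Lemma 2 (proof, p. 175: "`< 2^{N+3} T(N) = 2^{log T(N) + N + 3}`")] -/
theorem succ_mul_inc_lt (s : ℕ) : (s + 1) * inc s < 2 ^ sufLen s := by
  set ℓ := Nat.log 2 (s + 1) with hℓ
  have h1 : s + 1 < 2 ^ (ℓ + 1) := Nat.lt_pow_succ_log_self one_lt_two _
  have h2 : (s + 1) ^ 3 < (2 ^ (ℓ + 1)) ^ 3 := Nat.pow_lt_pow_left h1 (by norm_num)
  have hc := one_le_clock s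
  have h3 : inc s ≤ 3 * nb s * clock s := by
    unfold inc
    nlinarith [Nat.zero_le (nb s)]
  have hpos : 0 < 2 ^ s * clock s := Nat.mul_pos (Nat.two_pow_pos s) hc
  calc (s + 1) * inc s ≤ (s + 1) * (3 * nb s * clock s) := Nat.mul_le_mul_left _ h3
    _ = 3 * (s + 1) ^ 3 * (2 ^ s * clock s) := by unfold nb; ring
    _ < 4 * (2 ^ (ℓ + 1)) ^ 3 * (2 ^ s * clock s) := by
        refine Nat.mul_lt_mul_of_pos_right ?_ hpos
        have : 0 < (2 ^ (ℓ + 1)) ^ 3 := by positivity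
        omega
    _ = 2 ^ sufLen s := by
        unfold sufLen clock
        rw [show (4 : ℕ) = 2 ^ 2 from rfl, ← pow_mul, ← pow_add, ← pow_add, ← pow_add]
        congr 1
        ring

/-- **Fewer than `2^{a(s)}` strings are committed when `α_s` is chosen.** [cite: Wilson1985, Lemma 2 (proof, p. 175)] -/
theorem card_midCond_lt (s : ℕ) : (midCond e s).committed.card < 2 ^ sufLen s := by
  refine lt_of_le_of_lt ?_ (succ_mul_inc_lt s)
  calc (midCond e s).committed.card ≤ (stageCond e s).committed.card + nb s * clock s :=
        card_stageRun_le e s _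
    _ ≤ s * inc s + inc s := by
        refine Nat.add_le_add (card_stageCond_le e s) ?_
        unfold inc
        exact Nat.le_add_right _ _
    _ = (s + 1) * inc s := by ring

/-! ### Freshness, disjointness, and the oracle meets every stage -/

/-- **The codes of stage `s` are uncommitted when chosen.** [cite: Wilson1985, Lemma 2 (proof, p. 174, Step 2)] -/
theorem code_not_mem_midCond (s d : ℕ) (x : List Bool) :
    code d x (alpha e s) ∉ (midCond e s).committed := by
  intro h
  refine fresh_spec (card_midCond_lt e s) _ h ?_
  change lastN (sufLen s) (code d x (alpha e s)) = alpha e s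
  conv_lhs => rw [← length_alpha e s]
  exact lastN_code d x (alpha e s)

/-- Codes of stage `s` are neither IN nor OUT in the run condition. [folklore] -/
theorem code_not_mem_midCond' (s d : ℕ) (x : List Bool) :
    code d x (alpha e s) ∉ (midCond e s).I ∧ code d x (alpha e s) ∉ (midCond e s).O := by
  have h := code_not_mem_midCond e s d x
  rw [Cond.mem_committed, not_or] at h
  exact h

/-- **Every stage condition is disjoint.** [cite: Wilson1985, Lemma 2 (proof, p. 174: "any `⟨i, x⟩` will be in exactly one of `S₀` or `S₁`")] -/
theorem stageCond_disj (s : ℕ) : (stageCond e s).Disj := by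
  induction s with
  | zero => exact Cond.empty_disj
  | succ s ih =>
    have hmid : (midCond e s).Disj := procList_disj e _ ih
    rw [stageCond_succ]
    refine Finset.disjoint_left.2 fun u hI hO => ?_
    change u ∈ (midCond e s).I ∪ codesOf (alpha e s) (results e s) true at hI
    change u ∈ (midCond e s).O ∪ (codesOf (alpha e s) (results e s) false \
      codesOf (alpha e s) (results e s) true) at hO
    rw [Finset.mem_union] at hI hO
    rcases hI with hI | hI <;> rcases hO with hO | hO
    · exact Finset.disjoint_left.1 hmid hI hO
    · obtain ⟨dx, -, rfl⟩ := mem_codesOf_iff.1 (Finset.mem_sdiff.1 hO).1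
      exact (code_not_mem_midCond' e s dx.1 dx.2).1 hI
    · obtain ⟨dx, -, rfl⟩ := mem_codesOf_iff.1 hI
      exact (code_not_mem_midCond' e s dx.1 dx.2).2 hO
    · exact (Finset.mem_sdiff.1 hO).2 hI

/-- The run conditions are disjoint. [folklore] -/
theorem midCond_disj (s : ℕ) : (midCond e s).Disj :=
  procList_disj e _ (stageCond_disj e s)

/-- **The oracle meets every stage condition**: IN-strings are in `B` by definition, and an
OUT-string of stage `s` in `B` would be IN at some stage, contradicting disjointness at the
later of the two. [cite: Wilson1985, Lemma 2 (proof, p. 174: "no change to the oracle that could be made in later stages")] -/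
theorem meets_stageCond (s : ℕ) : Meets (oracle e) (stageCond e s) := by
  refine ⟨fun u hu => ⟨s, hu⟩, fun u hu ⟨t, ht⟩ => ?_⟩
  have hI : u ∈ (stageCond e (max s t)).I := (stageCond_mono e (le_max_right s t)).1 ht
  have hO : u ∈ (stageCond e (max s t)).O := (stageCond_mono e (le_max_left s t)).2 hu
  exact Finset.disjoint_left.1 (stageCond_disj e (max s t)) hI hO

/-- The oracle meets every run condition. [folklore] -/
theorem meets_midCond (s : ℕ) : Meets (oracle e) (midCond e s) :=
  (meets_stageCond e (s + 1)).anti (midCond_le_stageCond_succ e s)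

/-! ### The codes in the oracle -/

/-- An accepted pair has its code in the oracle. [cite: Wilson1985, Lemma 2 (proof, p. 174: "Put all of `S₁α` into `B`")] -/
theorem code_mem_oracle_of_true {s d : ℕ} {x : List Bool} (h : ((d, x), true) ∈ results e s) :
    code d x (alpha e s) ∈ oracle e :=
  ⟨s + 1, Finset.mem_union_right _ (mem_codesOf_iff.2 ⟨(d, x), h, rfl⟩)⟩

/-- A rejected pair has its code outside the oracle, unless the same pair was also accepted
(which does not happen for genuine descriptions). [cite: Wilson1985, Lemma 2 (proof, p. 174: "reserve all of `S₀α` for `B̄`")] -/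
theorem mem_results_true_of_false {s d : ℕ} {x : List Bool} (h : ((d, x), false) ∈ results e s)
    (hc : code d x (alpha e s) ∈ oracle e) : ((d, x), true) ∈ results e s := by
  by_contra hne
  have hF : code d x (alpha e s) ∈ codesOf (alpha e s) (results e s) false :=
    mem_codesOf_iff.2 ⟨(d, x), h, rfl⟩
  have hT : code d x (alpha e s) ∉ codesOf (alpha e s) (results e s) true := by
    intro hT
    obtain ⟨⟨d', x'⟩, h', hc'⟩ := mem_codesOf_iff.1 hT
    obtain ⟨rfl, rfl⟩ := code_inj hc'
    exact hne h'
  have hO : code d x (alpha e s) ∈ (stageCond e (s + 1)).O :=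
    Finset.mem_union_right _ (Finset.mem_sdiff.2 ⟨hF, hT⟩)
  exact (meets_stageCond e (s + 1)).2 _ hO hc

/-- **Every recorded bit of a genuine description is correct**: the entry was produced by
processing `x` from a disjoint condition above `stageCond s`, the resulting condition lies below
`stageCond (s+1)`, which the oracle meets — so the simulation theorem applies.
[cite: Wilson1985, Lemma 2 (proof, p. 174)] -/
theorem results_correct {s d : ℕ} {x : List Bool} {b : Bool} (h : ((d, x), b) ∈ results e s)
    {L : Language Bool} (hD : (e d).Describes (oracle e) L) : b = L.boolIndicator x := by
  obtain ⟨σ₁, -, hdisj, hb, hfin⟩ := mem_procList e (blockList e s) (stageCond e s) h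
  rw [← hb]
  exact hD.process_eq x (hdisj (stageCond_disj e s)) ((meets_midCond e s).anti hfin)

/-- Every scheduled pair is recorded at its stage. [folklore] -/
theorem exists_mem_results (d : ℕ) (x : List Bool) :
    ∃ b : Bool, ((d, x), b) ∈ results e (sched e d x.length) :=
  exists_mem_procList e _ _ ((mem_blockList_iff e).2 rfl)

/-- **The coding theorem.** If description number `d` describes `L` relative to Wilson's oracle,
then for every input `x` the code of `(d, x)` with the suffix of its scheduled stage is in the
oracle iff `x ∈ L` (Wilson: "`x ∈ L ⇔ M_i^{K(B)}` accepts `x` within its time bound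
`⇔ ⟨i, x⟩ ∈ S₁` at stage `N` `⇔ ⟨i, x⟩α_N ∈ B`"). [cite: Wilson1985, Lemma 2 (proof, p. 174)] -/
theorem code_mem_oracle_iff {d : ℕ} {L : Language Bool} (hD : (e d).Describes (oracle e) L)
    (x : List Bool) : code d x (alpha e (sched e d x.length)) ∈ oracle e ↔ x ∈ L := by
  obtain ⟨b, hb⟩ := exists_mem_results e d x
  have hbL := results_correct e hb hD
  cases b with
  | true =>
    exact ⟨fun _ => (Set.mem_iff_boolIndicator _ _).2 hbL.symm, fun _ => code_mem_oracle_of_true e hb⟩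
  | false =>
    constructor
    · intro hc
      have h' := results_correct e (mem_results_true_of_false e hb hc) hD
      rw [← hbL] at h'
      cases h'
    · intro hx
      have := (Set.mem_iff_boolIndicator _ _).1 hx
      rw [← hbL] at this
      cases this

end Wilson

end Literature.Computability.Complexity
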